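import Mathlib
import HarnessLib
import Summits.NavierStokesRegularity.NavierStokesRegularity.Theorems.PoloidalWindowDoorLrcModEntireCaseISonicTimes
import Summits.NavierStokesRegularity.NavierStokesRegularity.Theorems.PoloidalWindowDoorLrcModEntireCaseISfreeEnd
import Summits.NavierStokesRegularity.NavierStokesRegularity.Theorems.PoloidalWindowDoorLrcModEntireCaseIPeriodicEnd
import Summits.NavierStokesRegularity.NavierStokesRegularity.Theorems.PoloidalWindowDoorLrcModEntireShearedDifferenceTemplate

/-!
# Route `PoloidalWindowDoor`, item `LrcModEntire` (stmt-NavierStokesRegularity-20428), cell (Q4-sonic, straight, μ < 0) `stub_Q4sonicLineNeg` —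
# CASE I «every nearby time sonic» CLOSED: the periodic END holds, and the v14 child `stub_Q4sonicLineNegSonicTimes` follows from `caseI_false_of_ends`

Cell ns-regularity-ideate, stub-worker seat ns-poloidal-K2-p2 g17 under the LEAD of item 20428 (ns-poloidal-K2-p3 g17; T2B-g17 §7–§10, `CASE-I-SPLIT-v14.md`
Child 1); `--supports stmt-NavierStokesRegularity-20428 --as helper`.

* ★★ `periodicEnd_holds` — the SECOND hypothesis of `…CaseISonicTimes.caseI_false_of_ends` (its text verbatim): from the binders, the parameter set
  `O = {(t,s,z) : t+1 ∈ (τ₁,τ₂), |z| < δ′}`, its `(t,z)`-shadow `Dμ` on which the slope is smooth (`…CaseISfreeEnd.exists_horizDeriv_ne_zero` +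
  `…SlopeSmooth`) and `≠ 1` (`μ < 0`), the offset `d(t,z) = n₀(t+1,0,z)` smooth on the box; the LEAD's sheared DIFFERENCE ROW (P2b `…ShearedDifferenceRow.differenceRow_sheared`:
  `verticalDifference_law` p745221 pulled back by the moving shear) in template shape with smooth coefficients (`…ShearedDifferenceTemplate`) is exactly
  hypothesis `hR3` of `…CaseIPeriodicEnd.periodicEnd_of_verticalRow` (p746244), which ends in `False` (template uniqueness for the difference field + `…HorizontalPeriodAtTime`).
* ★★★ `stub_Q4sonicLineNegSonicTimes_holds` — the v14 child statement (LineNeg package VERBATIM + the case-I literal LAST) :=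
  `caseI_false_of_ends sfreeEnd_holds periodicEnd_holds`.

WHAT THIS IS NOT: not a claim about Navier–Stokes regularity.  It closes the CASE-I child of the research slot `stub_Q4sonicLineNeg` of
`Cruxes/LrcModEntire/Lines/twist_split.lean` (v13 → v14 keyed by the LEAD/steward); `stub_Q4sonicLineNegIsolated` (case II), `stub_Q4curved*` remain research;
items 20428 / 19708 / 27893 stay OPEN (bears_on LADDER-NS N0).
-/

noncomputable section

set_option linter.dupNamespace false
set_option linter.style.longLine false

namespace Summit.NavierStokesRegularity.NavierStokesRegularity.Theorems.PoloidalWindowDoorLrcModEntireCaseIClosed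

open Set Function Filter Topology Metric
open scoped RealInnerProductSpace InnerProductSpace ContDiff Laplacian
open Literature.Analysis
open Summit.NavierStokesRegularity.NavierStokesRegularity.Theorems.LocalSineTubeDoorProfileAlignedWindowRigidityAncient
open Summit.NavierStokesRegularity.NavierStokesRegularity.Theorems.PoloidalWindowDoorPoloidalWindowRigidityWindow
open Summit.NavierStokesRegularity.NavierStokesRegularity.Theorems.PoloidalWindowDoorLrcModEntireSheetSystemUniqueness
open Summit.NavierStokesRegularity.NavierStokesRegularity.Theorems.PoloidalWindowDoorLrcModEntireSheetFlattenTools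
open Summit.NavierStokesRegularity.NavierStokesRegularity.Theorems.PoloidalWindowDoorLrcModEntireShearedCoordinates
open Summit.NavierStokesRegularity.NavierStokesRegularity.Theorems.PoloidalWindowDoorLrcModEntireShearedKinematics
open Summit.NavierStokesRegularity.NavierStokesRegularity.Theorems.PoloidalWindowDoorLrcModEntireSlopeSmooth
open Summit.NavierStokesRegularity.NavierStokesRegularity.Theorems.PoloidalWindowDoorLrcModEntireCaseISonicTimes
open Summit.NavierStokesRegularity.NavierStokesRegularity.Theorems.PoloidalWindowDoorLrcModEntireCaseISfreeEnd
open Summit.NavierStokesRegularity.NavierStokesRegularity.Theorems.PoloidalWindowDoorLrcModEntireCaseIPeriodicEnd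
open Summit.NavierStokesRegularity.NavierStokesRegularity.Theorems.PoloidalWindowDoorLrcModEntireShearedDifferenceTemplate

/-- ★★ **THE PERIODIC END HOLDS** (text of the second hypothesis of `…CaseISonicTimes.caseI_false_of_ends`). -/
theorem periodicEnd_holds : ∀ (C σ ρ δ' r : ℝ) (U : ℝ → EuclideanSpace ℝ (Fin 3) → EuclideanSpace ℝ (Fin 3)) (R μ : ℝ → ℝ → ℝ) (e : EuclideanSpace ℝ (Fin 3))
      (n₀ : ℝ × ℝ × ℝ → ℝ) (κt : ℝ → ℝ → ℝ) (τ₁ τ₂ L : ℝ),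
      Literature.Analysis.FluidPDE.HasTypeITimeDecay C U →
      ContinuousOn (Function.uncurry U) (Set.Iio (0 : ℝ) ×ˢ Set.univ) →
      (∀ s t : ℝ, s < t → t < 0 → ∀ x, U t x =
        Literature.Analysis.UnboundedOperators.heatExtension (U s) (t - s) x - Literature.Analysis.FluidPDE.oseenDuhamel 1 s U U t x) →
      (∀ t < 0, Literature.Analysis.FluidPDE.VectorCalculus.IsDivFree (U t)) →
      (∀ s < 0, ∀ y, ⟪Literature.Analysis.FluidPDE.curl (U s) y, EuclideanSpace.single 2 1⟫_ℝ = 0) →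
      U (-1) 0 2 ≠ 0 → (σ = 1 ∨ σ = -1) → ContDiff ℝ 3 (Function.uncurry μ) →
      (∀ t : ℝ, |t + 1| < ρ → ∀ x : EuclideanSpace ℝ (Fin 3), |x 2| < ρ → ∀ b : Fin 3, b ≠ 2 →
        fderiv ℝ (U t) x (EuclideanSpace.single 2 1) b = μ t (x 2) * fderiv ℝ (U t) x (EuclideanSpace.single b 1) 2) →
      δ' ≤ ρ → δ' < 1 / 2 → e 2 = 0 → e 0 ^ 2 + e 1 ^ 2 = 1 →
      (∀ q : ℝ × ℝ × ℝ, |q.1| < δ' → |q.2.2| < δ' →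
        n₀ q ∈ Set.Ioo (-r) r ∧
        σ * U (-1 + q.1) (frameCLM e (q.2.1, n₀ q, q.2.2)) 2 = R q.1 q.2.2 ∧
        (∀ n ∈ Set.Icc (-r) r, n ≠ n₀ q → σ * U (-1 + q.1) (frameCLM e (q.2.1, n, q.2.2)) 2 < R q.1 q.2.2) ∧
        (∀ w : EuclideanSpace ℝ (Fin 3), w 2 = 0 → fderiv ℝ (fun y => U (-1 + q.1) y 2) (frameCLM e (q.2.1, n₀ q, q.2.2)) w = 0) ∧
        (∀ m : ℕ∞, ContDiffAt ℝ m n₀ q) ∧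
        0 < κt q.1 q.2.2 ∧
        fderiv ℝ (fderiv ℝ (fun y => σ * U (-1 + q.1) y 2)) (frameCLM e (q.2.1, n₀ q, q.2.2)) e e +
            fderiv ℝ (fderiv ℝ (fun y => σ * U (-1 + q.1) y 2)) (frameCLM e (q.2.1, n₀ q, q.2.2)) (Jvec e) (Jvec e) =
          -κt q.1 q.2.2 ∧
        κt q.1 q.2.2 * (fderiv ℝ n₀ q ((0 : ℝ), (0 : ℝ), (1 : ℝ))) ^ 2 =
          (deriv (deriv (R q.1)) q.2.2 - μ (-1 + q.1) q.2.2 * κt q.1 q.2.2) * (1 + (fderiv ℝ n₀ q ((0 : ℝ), (1 : ℝ), (0 : ℝ))) ^ 2)) →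
      (∀ τ : ℝ, |τ| < δ' → ∃ A B : ℝ, ∀ z : ℝ, |z| < δ' → R τ z = A + B * z) →
      (∀ τ s z : ℝ, |τ| < δ' → |z| < δ' → n₀ (τ, s, z) = n₀ (τ, (0 : ℝ), z)) →
      (∀ τ z : ℝ, |τ| < δ' → |z| < δ' → μ (-1 + τ) z < 0) →
      -δ' ≤ τ₁ → τ₁ < τ₂ → τ₂ ≤ δ' → 0 < L →
      (∀ τ ∈ Set.Ioo τ₁ τ₂, ∀ s z : ℝ, |z| < δ' →
        U (-1 + τ) (frameCLM e (s + L, n₀ (τ, s + L, z), z)) = U (-1 + τ) (frameCLM e (s, n₀ (τ, s, z), z))) → False := by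
  intro C σ ρ δ' r U R μ e n₀ κt τ₁ τ₂ L hrate hcont hmild hdiv hpol hUne hσ hμ3 hslabU hδ'ρ hδ'h he2 hunit hpack hsonI hparI hμnegB hτ₁ hτ₁₂ hτ₂ hL hper
  have hJabs : ∀ τ ∈ Ioo τ₁ τ₂, |τ| < δ' := fun τ hτ => abs_lt.2 ⟨by linarith [hτ.1], by linarith [hτ.2]⟩
  have hδ' : 0 < δ' := by linarith
  set d : ℝ × ℝ → ℝ := fun q => n₀ (q.1 + 1, (0 : ℝ), q.2) with hd_def
  -- the parameter set, its `(t,z)`-shadow, the box of `d`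
  set O : Set Y3 := {y | y.1 + 1 ∈ Ioo τ₁ τ₂ ∧ |y.2.2| < δ'} with hO_def
  set Dμ : Set (ℝ × ℝ) := {p | p.1 + 1 ∈ Ioo τ₁ τ₂ ∧ |p.2| < δ'} with hDμ_def
  have hO : IsOpen O := by
    have h1 : IsOpen {y : Y3 | y.1 + 1 ∈ Ioo τ₁ τ₂} := isOpen_Ioo.preimage (continuous_fst.add continuous_const)
    have h2 : IsOpen {y : Y3 | |y.2.2| < δ'} := isOpen_lt (continuous_abs.comp (continuous_snd.comp continuous_snd)) continuous_const
    exact h1.inter h2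
  have hDμ : IsOpen Dμ := by
    have h1 : IsOpen {p : ℝ × ℝ | p.1 + 1 ∈ Ioo τ₁ τ₂} := isOpen_Ioo.preimage (continuous_fst.add continuous_const)
    have h2 : IsOpen {p : ℝ × ℝ | |p.2| < δ'} := isOpen_lt (continuous_abs.comp continuous_snd) continuous_const
    exact h1.inter h2
  have hObox : ∀ y ∈ O, |y.1 + 1| < δ' ∧ |y.2.2| < δ' := fun y hy => ⟨hJabs _ hy.1, hy.2⟩
  have hOt : ∀ y ∈ O, y.1 < 0 ∧ |y.1 + 1| < ρ ∧ |y.2.2| < ρ := by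
    intro y hy
    obtain ⟨h1, h2⟩ := hObox y hy
    exact ⟨by linarith [(abs_lt.1 h1).2], lt_of_lt_of_le h1 hδ'ρ, lt_of_lt_of_le h2 hδ'ρ⟩
  have hOμ : ∀ y ∈ O, (y.1, y.2.2) ∈ Dμ := fun y hy => hy
  have hμ1 : ∀ y ∈ O, μ y.1 y.2.2 ≠ 1 := by
    intro y hy
    have h := hμnegB (y.1 + 1) y.2.2 (hJabs _ hy.1) hy.2
    rw [show -1 + (y.1 + 1) = y.1 by ring] at h
    linarith
  -- the class profile is jointly smooth on `Iio 0 × ℝ³`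
  have hA := isTypeIAncientMild_of_class hrate hcont hmild hdiv
  set T : Set ℝ := Iio 0 with hT_def
  have hT : IsOpen T := isOpen_Iio
  have hW : ContDiffOn ℝ ∞ (uncurry U) (T ×ˢ (univ : Set E3)) := hA.contDiffOn
  have hOT : ∀ y ∈ O, y.1 ∈ T := fun y hy => (hOt y hy).1
  -- smoothness of the slope on `Dμ`
  set T' : Set ℝ := {t | |t + 1| < ρ} ∩ Iio 0 with hT'_def
  have hT' : IsOpen T' := (isOpen_lt (continuous_abs.comp (continuous_id.add continuous_const)) continuous_const).inter isOpen_Iio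
  have hUT' : ContDiffOn ℝ ∞ (uncurry U) (T' ×ˢ (univ : Set E3)) := hA.contDiffOn.mono (prod_mono (fun t ht => ht.2) Subset.rfl)
  have hslabT : ∀ t ∈ T', ∀ x : E3, |x 2| < ρ → ∀ b : Fin 3, b ≠ 2 →
      fderiv ℝ (U t) x (EuclideanSpace.single 2 1) b = μ t (x 2) * fderiv ℝ (U t) x (EuclideanSpace.single b 1) 2 := fun t ht => hslabU t ht.1
  have hμs : ContDiffOn ℝ ∞ (uncurry μ) Dμ := by
    intro p hp
    have hτ : |p.1 + 1| < δ' := hJabs _ hp.1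
    obtain ⟨x₀, b, hx₀2, hb, hgrad⟩ := exists_horizDeriv_ne_zero (U := U) (κt := κt) hrate hcont hmild hδ'h he2 hpack hτ hp.2
    have ht0T : -1 + (p.1 + 1) ∈ T' := by
      refine ⟨?_, ?_⟩
      · show |-1 + (p.1 + 1) + 1| < ρ
        rw [show -1 + (p.1 + 1) + 1 = p.1 + 1 by ring]; exact lt_of_lt_of_le hτ hδ'ρ
      · show -1 + (p.1 + 1) < 0
        linarith [(abs_lt.1 (lt_trans hτ hδ'h)).2]
    have hx₀ρ : |x₀ 2| < ρ := by rw [hx₀2]; exact lt_of_lt_of_le hp.2 hδ'ρ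
    have h := slope_contDiffAt_of_horizDeriv_ne_zero hT' hUT' hslabT ht0T hx₀ρ hb hgrad
    rw [hx₀2, show -1 + (p.1 + 1) = p.1 by ring] at h
    exact h.contDiffWithinAt
  -- the offset `d(t,z) = n₀(t+1,0,z)` is smooth on the box
  set D : Set (ℝ × ℝ) := {q | |q.1 + 1| < δ' ∧ |q.2| < δ'} with hD_def
  have hD : IsOpen D := by
    refine IsOpen.and ?_ ?_
    · exact isOpen_lt (continuous_abs.comp (continuous_fst.add continuous_const)) continuous_const
    · exact isOpen_lt (continuous_abs.comp continuous_snd) continuous_const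
  have hd : ContDiffOn ℝ ∞ d D := by
    intro q hq
    obtain ⟨-, -, -, -, hnC, -, -, -⟩ := hpack (q.1 + 1, (0 : ℝ), q.2) hq.1 hq.2
    have hline : ContDiff ℝ ∞ (fun q' : ℝ × ℝ => ((q'.1 + 1, (0 : ℝ), q'.2) : ℝ × ℝ × ℝ)) :=
      (contDiff_fst.add contDiff_const).prodMk (contDiff_const.prodMk contDiff_snd)
    have h1 : ContDiffAt ℝ ∞ n₀ ((fun q' : ℝ × ℝ => ((q'.1 + 1, (0 : ℝ), q'.2) : ℝ × ℝ × ℝ)) q) := by simpa using hnC ⊤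
    exact (h1.comp q hline.contDiffAt).contDiffWithinAt
  have hOD : ∀ y ∈ O, (y.1, y.2.2) ∈ D := fun y hy => hObox y hy
  have ha : (L • e) 2 = 0 := by simp [he2]
  -- the coefficients of the sheared difference row (LEAD's `differenceRow_sheared`, template shape `…ShearedDifferenceTemplate`) are smooth on the tube …
  obtain ⟨hα₂, hα₃, hα₄, hα₅, hα₆, hα₇, hα₈⟩ :=
    difference_coeffs_smooth (e := e) (a := L • e) hT hW hOT hDμ hμs hOμ hμ1 hD hd hOD
  -- … and the row itself is hypothesis `hR3` of `periodicEnd_of_verticalRow`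
  exact periodicEnd_of_verticalRow hrate hcont hmild hdiv hpol hUne hslabU hδ'ρ hδ'h he2 hunit hpack hparI hτ₁ hτ₁₂ hτ₂ hL hper
    (contDiffOn_const (c := (-1 : ℝ))) hα₂ hα₃ hα₄ hα₅ hα₆ hα₇ hα₈
    (fun p hp => differenceRow_template hrate hcont hmild hdiv hpol hμ3 hslabU he2 hunit ha hO hOt hμ1 hD hd hOD hp)

/-- ★★★ **THE v14 CHILD `stub_Q4sonicLineNegSonicTimes` (CASE I «every nearby time sonic») — CLOSED.**  Statement: the registered `stub_Q4sonicLineNeg`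
(`Cruxes/LrcModEntire/Lines/twist_split.lean` v13) VERBATIM with the case-I literal `∃ δ′>0, ∀ |τ|<δ′, R(τ,·)` affine on `|z|<δ` appended LAST
(`CASE-I-SPLIT-v14.md` Child 1). -/
theorem stub_Q4sonicLineNegSonicTimes_holds :
    ∀ (C : ℝ) (v : ℝ → EuclideanSpace ℝ (Fin 3) → EuclideanSpace ℝ (Fin 3)) (W : Set (ℝ × EuclideanSpace ℝ (Fin 3))),
      (Literature.Analysis.FluidPDE.HasTypeITimeDecay C v ∧
        ContinuousOn (Function.uncurry v) (Set.Iio (0 : ℝ) ×ˢ Set.univ) ∧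
        (∀ s t : ℝ, s < t → t < 0 → ∀ x, v t x =
          Literature.Analysis.UnboundedOperators.heatExtension (v s) (t - s) x -
            Literature.Analysis.FluidPDE.oseenDuhamel 1 s v v t x) ∧
        (∀ t < 0, Literature.Analysis.FluidPDE.VectorCalculus.IsDivFree (v t)) ∧
        (∀ s < 0, ∀ y, ⟪Literature.Analysis.FluidPDE.curl (v s) y, EuclideanSpace.single 2 1⟫_ℝ = 0) ∧
        v (-1) 0 2 ≠ 0 ∧ (∀ t < 0, ∀ x, Real.sqrt (-t) * |v t x 2| ≤ |v (-1) 0 2|) ∧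
        (∀ h : EuclideanSpace ℝ (Fin 3), fderiv ℝ (v (-1)) 0 h 2 = 0) ∧
        (deriv (fun s => v s 0 2) (-1) = v (-1) 0 2 / 2 ∧ v (-1) 0 2 * (Δ (fun y => v (-1) y 2)) 0 ≤ 0)) →
      (IsOpen W ∧ W.Nonempty ∧ W ⊆ Set.Iio (0 : ℝ) ×ˢ Set.univ ∧
        (∀ z ∈ W, (Literature.Analysis.FluidPDE.curl (v z.1) z.2 ≠ 0 ∧
            (fderiv ℝ (v z.1) z.2 (EuclideanSpace.single 0 1) 2 ≠ 0 ∨ fderiv ℝ (v z.1) z.2 (EuclideanSpace.single 1 1) 2 ≠ 0) ∧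
            (fderiv ℝ (v z.1) z.2 (EuclideanSpace.single 2 1) 0 ≠ 0 ∨ fderiv ℝ (v z.1) z.2 (EuclideanSpace.single 2 1) 1 ≠ 0))) ∧
        (∀ m : ℝ → ℝ, ∀ W₁ : Set (ℝ × EuclideanSpace ℝ (Fin 3)), W₁ ⊆ W → IsOpen W₁ → W₁.Nonempty →
            ∃ z ∈ W₁, ∃ b : Fin 3, b ≠ 2 ∧
              fderiv ℝ (v z.1) z.2 (EuclideanSpace.single 2 1) b ≠
                m z.1 * fderiv ℝ (v z.1) z.2 (EuclideanSpace.single b 1) 2) ∧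
        (∀ z ∈ W, (fderiv ℝ (fun x => fderiv ℝ (v z.1) x (EuclideanSpace.single 2 1) 2) z.2 (EuclideanSpace.single 0 1) *
                fderiv ℝ (v z.1) z.2 (EuclideanSpace.single 1 1) 2 -
              fderiv ℝ (fun x => fderiv ℝ (v z.1) x (EuclideanSpace.single 2 1) 2) z.2 (EuclideanSpace.single 1 1) *
                fderiv ℝ (v z.1) z.2 (EuclideanSpace.single 0 1) 2 ≠ 0)) ∧
        (∃ m : ℝ → ℝ → ℝ, ∀ z ∈ W, ∀ b : Fin 3, b ≠ 2 →
            fderiv ℝ (v z.1) z.2 (EuclideanSpace.single 2 1) b =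
              m z.1 (z.2 2) * fderiv ℝ (v z.1) z.2 (EuclideanSpace.single b 1) 2)) →
      (∀ t < 0, ∀ x x' : EuclideanSpace ℝ (Fin 3), x 2 = x' 2 → ∀ b c : Fin 3, b ≠ 2 → c ≠ 2 →
        fderiv ℝ (v t) x (EuclideanSpace.single 2 1) b * fderiv ℝ (v t) x' (EuclideanSpace.single c 1) 2 =
          fderiv ℝ (v t) x' (EuclideanSpace.single 2 1) c * fderiv ℝ (v t) x (EuclideanSpace.single b 1) 2) →
      (∀ (s z₀ σ M : ℝ) (K O : Set (EuclideanSpace ℝ (Fin 3))), s < 0 →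
        ((σ = 1 ∨ σ = -1) ∧ IsCompact K ∧ K.Nonempty ∧ (∀ y ∈ K, y 2 = z₀ ∧ σ * v s y 2 = M) ∧
          IsOpen O ∧ K ⊆ O ∧ (∀ y ∈ O, y 2 = z₀ → σ * v s y 2 ≤ M) ∧
          (∀ y ∈ O, y 2 = z₀ → σ * v s y 2 = M → y ∈ K)) → False) →
      (∀ s < 0, ∀ y, ⟪fderiv ℝ (v s) y (Literature.Analysis.FluidPDE.curl (v s) y), EuclideanSpace.single 2 1⟫_ℝ = 0) →
      IsClosed ({y : EuclideanSpace ℝ (Fin 3) | y 2 = 0 ∧ v (-1) y 2 = v (-1) 0 2}) →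
      (∀ y ∈ {y : EuclideanSpace ℝ (Fin 3) | y 2 = 0 ∧ v (-1) y 2 = v (-1) 0 2}, fderiv ℝ (fun x => v (-1) x 2) y = 0) →
      (∀ K O : Set (EuclideanSpace ℝ (Fin 3)), IsCompact K → K.Nonempty → K ⊆ {y : EuclideanSpace ℝ (Fin 3) | y 2 = 0 ∧ v (-1) y 2 = v (-1) 0 2} →
        IsOpen O → K ⊆ O → O ∩ {y : EuclideanSpace ℝ (Fin 3) | y 2 = 0 ∧ v (-1) y 2 = v (-1) 0 2} ⊆ K → False) →
      (∀ y ∈ {y : EuclideanSpace ℝ (Fin 3) | y 2 = 0 ∧ v (-1) y 2 = v (-1) 0 2}, ∀ r : ℝ, 0 < r →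
        ∃ y' : EuclideanSpace ℝ (Fin 3), y' 2 = 0 ∧ dist y' y < r ∧ v (-1) y' 2 ≠ v (-1) 0 2) →
      (∀ y ∈ {y : EuclideanSpace ℝ (Fin 3) | y 2 = 0 ∧ v (-1) y 2 = v (-1) 0 2}, Literature.Analysis.FluidPDE.curl (v (-1)) y = 0) →
      ∀ (σ κ : ℝ) (y₁ : EuclideanSpace ℝ (Fin 3)) (c₁ : Fin 3), (σ = 1 ∨ σ = -1) → σ * v (-1) 0 2 = |v (-1) 0 2| → 0 < κ →
        (∀ y : EuclideanSpace ℝ (Fin 3), y 2 = 0 → v (-1) y 2 = v (-1) 0 2 →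
          fderiv ℝ (fderiv ℝ (fun x => σ * v (-1) x 2)) y (EuclideanSpace.single 0 1) (EuclideanSpace.single 0 1) +
            fderiv ℝ (fderiv ℝ (fun x => σ * v (-1) x 2)) y (EuclideanSpace.single 1 1) (EuclideanSpace.single 1 1) = -κ) →
        y₁ 2 = 0 → c₁ ≠ 2 → fderiv ℝ (v (-1)) y₁ (EuclideanSpace.single c₁ 1) 2 ≠ 0 →
        (∃ (γ : ℝ → EuclideanSpace ℝ (Fin 3)) (φ : ℕ → ℕ) (U : ℝ → EuclideanSpace ℝ (Fin 3) → EuclideanSpace ℝ (Fin 3)) (Γ νΓ : ℝ → EuclideanSpace ℝ (Fin 3))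
        (F : ℝ → EuclideanSpace ℝ (Fin 3) → ℝ) (R : ℝ → ℝ → ℝ) (r δ m : ℝ) (μ : ℝ → ℝ → ℝ) (ρ : ℝ),
        -- the complete hot branch of BRANCH-PARAM (LEAD g15 `exists_complete_hotBranch_of_ridge`)
        ((ContDiff ℝ 2 γ ∧ γ 0 = 0 ∧ (∀ s, γ s 2 = 0) ∧ (∀ s, ‖deriv γ s‖ = 1) ∧ (∀ s, v (-1) (γ s) 2 = v (-1) 0 2) ∧
          (∀ s, fderiv ℝ (fderiv ℝ (fun y => σ * v (-1) y 2)) (γ s) (WithLp.toLp 2 ![-(deriv γ s 1), deriv γ s 0, 0])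
            (WithLp.toLp 2 ![-(deriv γ s 1), deriv γ s 0, 0]) = -κ) ∧
          (∀ s w, fderiv ℝ (fderiv ℝ (fun y => σ * v (-1) y 2)) (γ s) (deriv γ s) w = 0)) ∧ StrictMono φ ∧
        -- the hull limit (pinned, peakless, same hot value), slices converging locally uniformly, re-based branches converging to `Γ`
        (Literature.Analysis.FluidPDE.HasTypeITimeDecay C U ∧
          ContinuousOn (Function.uncurry U) (Set.Iio (0 : ℝ) ×ˢ Set.univ) ∧
          (∀ s t : ℝ, s < t → t < 0 → ∀ x, U t x =
            Literature.Analysis.UnboundedOperators.heatExtension (U s) (t - s) x -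
              Literature.Analysis.FluidPDE.oseenDuhamel 1 s U U t x) ∧
          (∀ t < 0, Literature.Analysis.FluidPDE.VectorCalculus.IsDivFree (U t)) ∧
          (∀ s < 0, ∀ q, ⟪Literature.Analysis.FluidPDE.curl (U s) q, EuclideanSpace.single 2 1⟫_ℝ = 0) ∧
          U (-1) 0 2 ≠ 0 ∧ (∀ t < 0, ∀ x, Real.sqrt (-t) * |U t x 2| ≤ |U (-1) 0 2|) ∧
          (∀ h : EuclideanSpace ℝ (Fin 3), fderiv ℝ (U (-1)) 0 h 2 = 0) ∧
          (deriv (fun s => U s 0 2) (-1) = U (-1) 0 2 / 2 ∧ U (-1) 0 2 * (Δ (fun q => U (-1) q 2)) 0 ≤ 0)) ∧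
        (∀ (s z₀ σ M : ℝ) (K O : Set (EuclideanSpace ℝ (Fin 3))), s < 0 →
          ((σ = 1 ∨ σ = -1) ∧ IsCompact K ∧ K.Nonempty ∧ (∀ q ∈ K, q 2 = z₀ ∧ σ * U s q 2 = M) ∧
            IsOpen O ∧ K ⊆ O ∧ (∀ q ∈ O, q 2 = z₀ → σ * U s q 2 ≤ M) ∧
            (∀ q ∈ O, q 2 = z₀ → σ * U s q 2 = M → q ∈ K)) → False) ∧
        U (-1) 0 2 = v (-1) 0 2 ∧
        (∀ t < 0, TendstoLocallyUniformly (fun j x => v t (x + γ ((φ j : ℕ) : ℝ))) (U t) atTop) ∧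
        (∀ s, Tendsto (fun j => γ (((φ j : ℕ) : ℝ) + s) - γ ((φ j : ℕ) : ℝ)) atTop (𝓝 (Γ s))) ∧
        -- re-entry package of the limit branch
        (∀ y ∈ {y : EuclideanSpace ℝ (Fin 3) | y 2 = 0 ∧ U (-1) y 2 = U (-1) 0 2}, fderiv ℝ (fun x => U (-1) x 2) y = 0) ∧
        ContDiff ℝ ∞ Γ ∧ Γ 0 = 0 ∧ (∀ s, Γ s 2 = 0) ∧ (∀ s, ‖deriv Γ s‖ = 1) ∧ (∀ s, U (-1) (Γ s) 2 = U (-1) 0 2) ∧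
        (∀ s, νΓ s = WithLp.toLp 2 ![-(deriv Γ s 1), deriv Γ s 0, 0]) ∧
        (∀ s, κ ≤ -(fderiv ℝ (fderiv ℝ (fun y => σ * U (-1) y 2)) (Γ s) (νΓ s) (νΓ s))) ∧
        -- the signed space–time component, the homogeneous ridge height, the tube radius, the window, the level
        (F = fun τ y => σ * U (-1 + τ) y 2) ∧
        (∀ τ z, R τ z = sSup ((fun n : ℝ => F τ (Γ 0 + n • νΓ 0 + z • EuclideanSpace.single 2 (1 : ℝ))) '' Icc (-r) r)) ∧
        0 < r ∧ 0 < δ ∧ δ ≤ 1 / 4 ∧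
        -- (Q3∞): the cross-section maximum is homogeneous along `Γ`
        (∀ τ z : ℝ, |τ| < δ → |z| < δ → ∀ s : ℝ,
          sSup ((fun n : ℝ => F τ (Γ s + n • νΓ s + z • EuclideanSpace.single 2 (1 : ℝ))) '' Icc (-r) r) = R τ z) ∧
        -- cold lateral values, hot centre
        (∀ τ z : ℝ, |τ| < δ → |z| < δ → ∀ s n : ℝ, (n = r ∨ n = -r) → F τ (Γ s + n • νΓ s + z • EuclideanSpace.single 2 (1 : ℝ)) < m) ∧
        (∀ τ z : ℝ, |τ| < δ → |z| < δ → ∀ s : ℝ, m ≤ F τ (Γ s + z • EuclideanSpace.single 2 (1 : ℝ))) ∧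
        -- strict concavity of the cross-sections on the open tube
        (∀ τ z : ℝ, |τ| < δ → |z| < δ → ∀ s : ℝ, ∀ n ∈ Ioo (-r) r,
          fderiv ℝ (fderiv ℝ (F τ)) (Γ s + n • νΓ s + z • EuclideanSpace.single 2 (1 : ℝ)) (νΓ s) (νΓ s) < 0) ∧
        -- THE WEB FERMAT LAW at every cross-section
        (∀ τ₀ z₀ : ℝ, |τ₀| < δ → |z₀| < δ → ∀ s₀ : ℝ, ∃ n₀ ∈ Ioo (-r) r,
          F τ₀ (Γ s₀ + n₀ • νΓ s₀ + z₀ • EuclideanSpace.single 2 (1 : ℝ)) = R τ₀ z₀ ∧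
          (∀ n ∈ Icc (-r) r, n ≠ n₀ → F τ₀ (Γ s₀ + n • νΓ s₀ + z₀ • EuclideanSpace.single 2 (1 : ℝ)) < R τ₀ z₀) ∧
          DifferentiableAt ℝ (uncurry R) (τ₀, z₀) ∧
          fderiv ℝ (uncurry F) (τ₀, Γ s₀ + n₀ • νΓ s₀ + z₀ • EuclideanSpace.single 2 (1 : ℝ)) =
            (fderiv ℝ (uncurry R) (τ₀, z₀)).comp
              ((ContinuousLinearMap.fst ℝ ℝ (EuclideanSpace ℝ (Fin 3))).prod
                ((EuclideanSpace.proj (2 : Fin 3)).comp (ContinuousLinearMap.snd ℝ ℝ (EuclideanSpace ℝ (Fin 3)))))) ∧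
        -- (TH) STRUCTURE OF THE HULL ELEMENT: the global bilinear identity, the frozen law, and the slope function of `v` on a uniform slab — the SAME `μ` for `U`
        (∀ t < 0, ∀ x x' : EuclideanSpace ℝ (Fin 3), x 2 = x' 2 → ∀ b c : Fin 3, b ≠ 2 → c ≠ 2 →
          fderiv ℝ (U t) x (EuclideanSpace.single 2 1) b * fderiv ℝ (U t) x' (EuclideanSpace.single c 1) 2 =
            fderiv ℝ (U t) x' (EuclideanSpace.single 2 1) c * fderiv ℝ (U t) x (EuclideanSpace.single b 1) 2) ∧
        (∀ s < 0, ∀ y, ⟪fderiv ℝ (U s) y (Literature.Analysis.FluidPDE.curl (U s) y), EuclideanSpace.single 2 1⟫_ℝ = 0) ∧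
        0 < ρ ∧ ρ ≤ 1 ∧ ContDiff ℝ 3 (uncurry μ) ∧
        μ (-1) 0 = fderiv ℝ (v (-1)) y₁ (EuclideanSpace.single 2 1) c₁ / fderiv ℝ (v (-1)) y₁ (EuclideanSpace.single c₁ 1) 2 ∧
        (∀ t : ℝ, |t + 1| < ρ → ∀ x : EuclideanSpace ℝ (Fin 3), |x 2| < ρ → ∀ b : Fin 3, b ≠ 2 →
          fderiv ℝ (v t) x (EuclideanSpace.single 2 1) b = μ t (x 2) * fderiv ℝ (v t) x (EuclideanSpace.single b 1) 2) ∧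
        (∀ t : ℝ, |t + 1| < ρ → ∀ x : EuclideanSpace ℝ (Fin 3), |x 2| < ρ → ∀ b : Fin 3, b ≠ 2 →
          fderiv ℝ (U t) x (EuclideanSpace.single 2 1) b = μ t (x 2) * fderiv ℝ (U t) x (EuclideanSpace.single b 1) 2) ∧
        (∀ t₀ : ℝ, |t₀ + 1| < ρ → ∀ y₀ : EuclideanSpace ℝ (Fin 3), y₀ 2 = 0 →
          ∀ᶠ z in 𝓝 ((t₀, y₀) : ℝ × EuclideanSpace ℝ (Fin 3)), ∀ b : Fin 3, b ≠ 2 →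
            fderiv ℝ (U z.1) z.2 (EuclideanSpace.single 2 1) b = μ z.1 (z.2 2) * fderiv ℝ (U z.1) z.2 (EuclideanSpace.single b 1) 2)) ∧
        -- (v9) the sub-cell
        (∃ a b : ℝ, ∀ z : ℝ, |z| < δ → R 0 z = a + b * z) ∧
        -- (v11) the sub-sub-cell: straight branch, non-vanishing (hence negative) slope at the hot spot
        (∀ s : ℝ, Γ s = s • deriv Γ 0) ∧ ¬ (μ (-1) 0 = 0) ∧
        -- (v14) CASE I of T2B-g17 §1/§5: every nearby time is sonic
        (∃ δ' : ℝ, 0 < δ' ∧ ∀ τ : ℝ, |τ| < δ' → ∃ a b : ℝ, ∀ z : ℝ, |z| < δ → R τ z = a + b * z)) →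
        False :=
  caseI_false_of_ends sfreeEnd_holds periodicEnd_holds

end Summit.NavierStokesRegularity.NavierStokesRegularity.Theorems.PoloidalWindowDoorLrcModEntireCaseIClosed

end
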